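import Mathlib
import HarnessLib
import Summits.HubbardSuperconductivity.HubbardSuperconductivity.Theorems.KLProgrammeKLRegimeEnginePairTransferMemberDefectDiffClasses

/-!
# Route `KLProgramme` — ENGINE child gen 8 (stmt-HubbardSuperconductivity-20437 `KLRegimeEngineV17F2`), skeleton v2 class #5 rev 3: generic FACTORISATION of the class rows of
# the ξ doors — `klmd_norm_mul_sub_mul_le`, `klmd_sum3_ite_mul_le`, `klmd_sum2_ite_mul_le`, `klmd_sum2_mul_le`, `klmd_sum1_mul_le`
# (cell gate-hubbard-kl, seat hubbard-kl-k3c1-p1 g13, technique «composed-map remainder propagation»; model-free layer under the masses form of the ξ rows)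

WHY.  Every class row of `klmd_defect_le_rows` / `klmd_defectDiff_le_rows` (rows 34–37b of KLTC-INDEX v10) is the norm of a finite sum `Σ 𝟙[constraint]·(weight)·(kernel
product)` — ph direct: `Σ_{p σ p′}`, ph crossed: `Σ_{p p′}`, 6–2: `Σ_{p σ}` (no constraint), localisation: `Σ_z (rate)·(kernel)`.  The analytic lanes bound the KERNEL factor
uniformly (class-#1 sups `M`, or the smearing-Lipschitz numbers `η` of `…MemberDefectDiffSmearing` for a kernel DIFFERENCE via `klmd_norm_mul_sub_mul_le`) and the WEIGHT
factor in mass (two-shell / floor / born-overlap rows).  These generic lemmas make that factorisation one `exact` per row: `‖Σ 𝟙·w·K‖ ≤ N·Σ 𝟙·‖w‖` given `‖K‖ ≤ N` on the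
summation range (higher-order pattern unification supplies `w`, `K`, the constraint from the row's text).
Pure finite-sum algebra; nothing about the model is asserted; nothing asserts (X).3, (c), K3 or superconductivity.  0 kit · 0 lit.
-/

namespace Summit.HubbardSuperconductivity.HubbardSuperconductivity.Theorems.KLRegimeSplit

set_option linter.dupNamespace false -- summit = problem name (single-conjunct summit), D-0017

open Finset

/-! ## §1 Products -/

/-- `‖a₁b₁ − a₂b₂‖ ≤ ‖a₁ − a₂‖·‖b₁‖ + ‖a₂‖·‖b₁ − b₂‖` (kernel DIFFERENCE rows: one factor replaced by its difference). -/
theorem klmd_norm_mul_sub_mul_le (a₁ a₂ b₁ b₂ : ℂ) : ‖a₁ * b₁ - a₂ * b₂‖ ≤ ‖a₁ - a₂‖ * ‖b₁‖ + ‖a₂‖ * ‖b₁ - b₂‖ := by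
  have e : a₁ * b₁ - a₂ * b₂ = (a₁ - a₂) * b₁ + a₂ * (b₁ - b₂) := by ring
  rw [e]
  exact (norm_add_le _ _).trans (by rw [norm_mul, norm_mul])

/-- `‖a₁b₁ − a₂b₂‖ ≤ η_a·M_b + M_a·η_b` from `‖a₁ − a₂‖ ≤ η_a`, `‖b₁‖ ≤ M_b`, `‖a₂‖ ≤ M_a`, `‖b₁ − b₂‖ ≤ η_b`. -/
theorem klmd_norm_mul_sub_mul_le_of_le {a₁ a₂ b₁ b₂ : ℂ} {ηa ηb Ma Mb : ℝ} (ha : ‖a₁ - a₂‖ ≤ ηa) (hb : ‖b₁‖ ≤ Mb) (ha₂ : ‖a₂‖ ≤ Ma)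
    (hb' : ‖b₁ - b₂‖ ≤ ηb) : ‖a₁ * b₁ - a₂ * b₂‖ ≤ ηa * Mb + Ma * ηb :=
  (klmd_norm_mul_sub_mul_le a₁ a₂ b₁ b₂).trans
    (add_le_add (mul_le_mul ha hb (norm_nonneg _) ((norm_nonneg _).trans ha)) (mul_le_mul ha₂ hb' (norm_nonneg _) ((norm_nonneg _).trans ha₂)))

/-! ## §2 Constrained class sums: kernel sup × weight mass -/

section Sums

variable {α β γ : Type*} [Fintype α] [Fintype β] [Fintype γ]

/-- **Three nested sums with a constraint** (ph-direct shape): `‖Σ_a Σ_b Σ_c 𝟙[P]·(w·K)‖ ≤ N·Σ_a Σ_b Σ_c 𝟙[P]·‖w‖` if `‖K a b c‖ ≤ N` whenever `P a b c`. -/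
theorem klmd_sum3_ite_mul_le (P : α → β → γ → Prop) [∀ a b c, Decidable (P a b c)] (w K : α → β → γ → ℂ) {N : ℝ}
    (hK : ∀ a b c, P a b c → ‖K a b c‖ ≤ N) :
    ‖∑ a, ∑ b, ∑ c, (if P a b c then w a b c * K a b c else 0)‖ ≤ N * ∑ a, ∑ b, ∑ c, (if P a b c then ‖w a b c‖ else 0) := by
  rw [Finset.mul_sum]
  refine (norm_sum_le _ _).trans (sum_le_sum fun a _ => ?_)
  rw [Finset.mul_sum]
  refine (norm_sum_le _ _).trans (sum_le_sum fun b _ => ?_)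
  rw [Finset.mul_sum]
  refine (norm_sum_le _ _).trans (sum_le_sum fun c _ => ?_)
  split_ifs with h
  · rw [norm_mul, mul_comm N]
    exact mul_le_mul_of_nonneg_left (hK a b c h) (norm_nonneg _)
  · simp

/-- **Two nested sums with a constraint** (ph-crossed shape). -/
theorem klmd_sum2_ite_mul_le (P : α → γ → Prop) [∀ a c, Decidable (P a c)] (w K : α → γ → ℂ) {N : ℝ}
    (hK : ∀ a c, P a c → ‖K a c‖ ≤ N) :
    ‖∑ a, ∑ c, (if P a c then w a c * K a c else 0)‖ ≤ N * ∑ a, ∑ c, (if P a c then ‖w a c‖ else 0) := by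
  rw [Finset.mul_sum]
  refine (norm_sum_le _ _).trans (sum_le_sum fun a _ => ?_)
  rw [Finset.mul_sum]
  refine (norm_sum_le _ _).trans (sum_le_sum fun c _ => ?_)
  split_ifs with h
  · rw [norm_mul, mul_comm N]
    exact mul_le_mul_of_nonneg_left (hK a c h) (norm_nonneg _)
  · simp

/-- **Two nested sums, no constraint** (6–2 shape). -/
theorem klmd_sum2_mul_le (w K : α → β → ℂ) {N : ℝ} (hK : ∀ a b, ‖K a b‖ ≤ N) :
    ‖∑ a, ∑ b, w a b * K a b‖ ≤ N * ∑ a, ∑ b, ‖w a b‖ := by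
  rw [Finset.mul_sum]
  refine (norm_sum_le _ _).trans (sum_le_sum fun a _ => ?_)
  rw [Finset.mul_sum]
  refine (norm_sum_le _ _).trans (sum_le_sum fun b _ => ?_)
  rw [norm_mul, mul_comm N]
  exact mul_le_mul_of_nonneg_left (hK a b) (norm_nonneg _)

/-- **One sum against a pointwise kernel majorant** (localisation shape): `‖Σ_z r·K‖ ≤ Σ_z ‖r z‖·κ z` if `‖K z‖ ≤ κ z`. -/
theorem klmd_sum1_mul_le (r K : α → ℂ) (κ : α → ℝ) (hK : ∀ z, ‖K z‖ ≤ κ z) :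
    ‖∑ z, r z * K z‖ ≤ ∑ z, ‖r z‖ * κ z := by
  refine (norm_sum_le _ _).trans (sum_le_sum fun z _ => ?_)
  rw [norm_mul]
  exact mul_le_mul_of_nonneg_left (hK z) (norm_nonneg _)

end Sums

end Summit.HubbardSuperconductivity.HubbardSuperconductivity.Theorems.KLRegimeSplit
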